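import Literature.Probability.Percolation.KhSThreeDisorderBoundaryValuesArcs
import Literature.Probability.Percolation.TriSepEscape
import HarnessLib

/-!
# Boundary support of the link-pattern law for ANY number of marks: no strand crosses the strand of `z`

Topic `Literature/Probability/Percolation`; generic-`k` layer of the three-disorder lineage. For a `k`-marked discrete domain
`D : TriMarkedDomain k`, a boundary mid-edge `z` (bond `side v i = s(g, o)`, read at a face `v` with three `H_G`-sides, odd endpoint
`s ∈ {v, oppFace v i}` not a corner) and a configuration `ξ` of the XOR space `W_Ω(u₁,…,u_k,z)` (`TXb D v i s`):

★ `false_of_interleaved_link` — if the strand of `ξ` from `z` ends at the corner `y'₂` of a 3-MARKED RE-MARKING `D₃` of `D`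
(same sites, three of the marks of `D`) on whose arc `A'₀` the mid-edge `z` lies, then the other two corners `y'₀, y'₁` of `D₃` are NOT
linked to each other by `ξ`. In words: no strand of `ξ` separates `z` from its partner — the strands pairing the remaining corners stay
on one side of the strand of `z`. This is the planarity input of every boundary-support law of the lane ((B∂) at `k = 5`, KhS eq. (4)
at `k = 3`), obtained here for every `k` WITHOUT new topology: the two strands are cut out of `ξ` (`restrictOn`, a configuration with
exactly four odd faces `{s, y'₂, y'₀, y'₁}`), the result lies in the `k = 3` XOR space of `D₃` in the class `[z ↔ u'₂]`, and that class
is EMPTY by the tree's `k = 3` boundary-value theorem `classCount_two_eq_zero_of_stretch_zero` (the two-term form of Khristoforov–Smirnov eq. (4), p. 5).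

Tools: `restrictOn` / `xiDeg_restrictOn_of_mem` / `xiDeg_restrictOn_of_not_mem` / `xiLinked_restrictOn` (keeping the components of two
faces of a configuration with all side counts `≤ 2`), `odd_faces_of_component` (the odd faces met from an odd face are itself and its
partner). The re-marking itself (three corners in cyclic order with `z` on the first arc) is supplied by the caller (`TriMarkedDomain.remark`).

## References
* M. Khristoforov, S. Smirnov, *Percolation and O(1) loop model*, arXiv:2111.15612 (2021), §1.2 (arXiv v1 p. 2: loop configurations,
  «IP(ξ) is a union of disjoint paths, matching marked points»), §2 eq. (4) with Remark 6 (p. 5: the `k = 3` boundary values).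
* B. Bollobás, O. Riordan, *Percolation*, CUP (2006), Ch. 7 §7.2.2 (pp. 191–195): marked discrete domains; §7.2.3 p. 197 («or by relabelling», after Lemma 6): re-marking.

## Mathlib / tree
Tree: `MarkedLoopSpace.lean` (`odd_component`, `restrict_off_component` (pattern), `eq_or_eq_of_inc_three`, `mem_touching_of_side_mem`,
`corners`, `yc`, `mem_corners`), `KhSThreeDisorderObservable.lean` (`TXb`, `mem_TXb_iff`, `ParityIs`, `InClassX`, `AllSides`),
`KhSThreeDisorderBoundaryValues.lean` (`xiDeg_le_two_of_mem_TXb`, `classCount_two_eq_zero_of_stretch_zero`), `FivePointNormalisation.lean`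
(`N5.sideGraph`, `xiLinked_iff_reachable`), `TriSepEscape.lean` (`TriMarkedDomain.remark`).
-/

open Finset

namespace Literature.Probability.Percolation.MarkedLoops

open Literature.Probability.Percolation Literature.Probability.LatticeModels
open Literature.Probability.Percolation.FivePoint (side tau xiDeg XiLinked Inc inc_side)
open Literature.Probability.Percolation.FivePoint.N5 (sideGraph side_oppFace_oppIdx xiLinked_iff_reachable)
open TriMarkedDomain

section Restrict

variable {nm : ℕ} (D : TriMarkedDomain nm)

open Classical in
/-- **keeping the components of two faces**: the sides of `ξ` lying on a face reachable (in the side graph of `ξ`) from `s₀` or from `t₀`.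
[cite: KhristoforovSmirnov2021, §1.2 (arXiv v1 p. 2: «IP(ξ) … the union of connectivity components»)] -/
noncomputable def restrictOn (ξ : Finset (Sym2 (Site 2))) (s₀ t₀ : HexVertex) : Finset (Sym2 (Site 2)) :=
  ξ.filter fun e => ∃ F, ((sideGraph ξ).Reachable s₀ F ∨ (sideGraph ξ).Reachable t₀ F) ∧ ∃ j : Fin 3, e = side F j

variable {D}

/-- the kept predicate is closed under `ξ`-adjacency. [folklore] -/
private theorem keep_of_adj {ξ : Finset (Sym2 (Site 2))} {s₀ t₀ F F' : HexVertex}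
    (hP : (sideGraph ξ).Reachable s₀ F ∨ (sideGraph ξ).Reachable t₀ F) (h : (sideGraph ξ).Adj F F') :
    (sideGraph ξ).Reachable s₀ F' ∨ (sideGraph ξ).Reachable t₀ F' := by
  rcases hP with h1 | h1
  · exact Or.inl (h1.trans ⟨SimpleGraph.Walk.cons h SimpleGraph.Walk.nil⟩)
  · exact Or.inr (h1.trans ⟨SimpleGraph.Walk.cons h SimpleGraph.Walk.nil⟩)

/-- `restrictOn ⊆ ξ`. [cite: KhristoforovSmirnov2021, §1.2 (arXiv v1 p. 2)] -/
theorem restrictOn_subset (ξ : Finset (Sym2 (Site 2))) (s₀ t₀ : HexVertex) : restrictOn ξ s₀ t₀ ⊆ ξ := by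
  classical
  exact Finset.filter_subset _ _

/-- on a kept face the side count is unchanged. [cite: KhristoforovSmirnov2021, §1.2 (arXiv v1 p. 2)] -/
theorem xiDeg_restrictOn_of_mem {ξ : Finset (Sym2 (Site 2))} {s₀ t₀ F : HexVertex}
    (hP : (sideGraph ξ).Reachable s₀ F ∨ (sideGraph ξ).Reachable t₀ F) : xiDeg (restrictOn ξ s₀ t₀) F = xiDeg ξ F := by
  classical
  unfold xiDeg restrictOn
  congr 1
  refine Finset.filter_congr fun j _ => ?_
  rw [Finset.mem_filter]
  constructor
  · exact fun h => h.1
  · exact fun h => ⟨h, F, hP, j, rfl⟩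

/-- off the kept faces the side count vanishes (a kept side of `F` would be a side of a kept face sharing that bond, i.e. of `F` itself or
of the face across — which is then `ξ`-adjacent to `F`). [cite: KhristoforovSmirnov2021, §1.2 (arXiv v1 p. 2)] -/
theorem xiDeg_restrictOn_of_not_mem {ξ : Finset (Sym2 (Site 2))} (hξ : ξ ⊆ hBonds D) {s₀ t₀ F : HexVertex}
    (hP : ¬ ((sideGraph ξ).Reachable s₀ F ∨ (sideGraph ξ).Reachable t₀ F)) : xiDeg (restrictOn ξ s₀ t₀) F = 0 := by
  classical
  unfold xiDeg
  rw [Finset.card_eq_zero, Finset.filter_eq_empty_iff]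
  intro j _ hj
  change side F j ∈ restrictOn ξ s₀ t₀ at hj
  unfold restrictOn at hj
  rw [Finset.mem_filter] at hj
  obtain ⟨hmem, F'', hP'', j'', he⟩ := hj
  have heB : side F j ∈ hBonds D := hξ hmem
  have h1 : F ∈ triFacesTouching D.verts := mem_touching_of_side_mem D heB
  have h2 : oppFace F j ∈ triFacesTouching D.verts :=
    mem_touching_of_side_mem D (j := oppIdx F j) (by rw [side_oppFace_oppIdx]; exact heB)
  have h3 : F'' ∈ triFacesTouching D.verts := mem_touching_of_side_mem D (j := j'') (by rw [← he]; exact heB)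
  rcases eq_or_eq_of_inc_three D heB h1 h2 h3 (inc_side F j) (by rw [← side_oppFace_oppIdx F j]; exact inc_side _ _)
      (by rw [he]; exact inc_side _ _) (fun e => (hexGraph_adj_oppFace F j).ne e) with rfl | rfl
  · exact hP hP''
  · exact hP (keep_of_adj hP'' ⟨oppIdx F j, by rw [oppFace_oppFace], by rw [side_oppFace_oppIdx]; exact hmem⟩)

/-- linking from a kept face survives the restriction. [cite: KhristoforovSmirnov2021, §1.2 (arXiv v1 p. 2)] -/
theorem xiLinked_restrictOn {ξ : Finset (Sym2 (Site 2))} {s₀ t₀ Y Y' : HexVertex}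
    (hY : (sideGraph ξ).Reachable s₀ Y ∨ (sideGraph ξ).Reachable t₀ Y) (h : XiLinked ξ Y Y') :
    XiLinked (restrictOn ξ s₀ t₀) Y Y' := by
  classical
  unfold XiLinked at h ⊢
  induction h with
  | refl => exact Relation.ReflTransGen.refl
  | @tail b c hab hbc ih =>
    obtain ⟨j, hc, hmem⟩ := hbc
    have hb : (sideGraph ξ).Reachable s₀ b ∨ (sideGraph ξ).Reachable t₀ b := by
      have hYb : (sideGraph ξ).Reachable Y b := (xiLinked_iff_reachable ξ Y b).1 hab
      rcases hY with h1 | h1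
      · exact Or.inl (h1.trans hYb)
      · exact Or.inr (h1.trans hYb)
    refine ih.tail ⟨j, hc, ?_⟩
    unfold restrictOn
    rw [Finset.mem_filter]
    exact ⟨hmem, b, hb, j, rfl⟩

/-- **the odd faces of a component**: in a configuration with all side counts `≤ 2`, the odd faces reachable from an odd face `Y₁` with
partner `Y₂` (reachable, odd, `≠ Y₁`) are exactly `Y₁` and `Y₂`. [cite: KhristoforovSmirnov2021, §1.2 (arXiv v1 p. 2)] -/
theorem odd_faces_of_component {ξ : Finset (Sym2 (Site 2))} (hξ : ξ ⊆ hBonds D) (hdeg : ∀ F, xiDeg ξ F ≤ 2) {Y₁ Y₂ : HexVertex}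
    (h1 : Y₁ ∈ triFacesTouching D.verts) (ho1 : Odd (xiDeg ξ Y₁)) (h12 : (sideGraph ξ).Reachable Y₁ Y₂) (ho2 : Odd (xiDeg ξ Y₂))
    (hne : Y₂ ≠ Y₁) {F : HexVertex} (hF : (sideGraph ξ).Reachable Y₁ F) (hoF : Odd (xiDeg ξ F)) : F = Y₁ ∨ F = Y₂ := by
  by_cases hF1 : F = Y₁
  · exact Or.inl hF1
  · exact Or.inr (((odd_component D hξ hdeg h1 ho1).2 Y₂ F h12 hF ho2 hoF hne hF1).symm)

end Restrict

section Interleaved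

variable {nm : ℕ} {D : TriMarkedDomain nm}

/-- two marked domains on the same sites have the same `H_G`. [cite: KhristoforovSmirnov2021, §1.2 (arXiv v1 p. 2)] -/
theorem hBonds_eq_of_verts_eq {D' : TriMarkedDomain 3} (hV : D'.verts = D.verts) : hBonds D' = hBonds D := by
  unfold hBonds; rw [hV]

/-- ★ **NO STRAND CROSSES THE STRAND OF `z`.** Let `D₃` be a 3-marked domain on the same sites whose three corner faces are corner faces
of `D`, with the mid-edge `z` (bond `side v i = s(g,o)`) on its arc `A'₀`; let `ξ ∈ TXb D v i s` (odd endpoint `s` not a corner of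
`D`) link `s` to the opposite corner `y'₂` of `D₃`. Then `ξ` does NOT link the other two corners `y'₀`, `y'₁` of `D₃` to each other.
[cite: KhristoforovSmirnov2021, §1.2 (arXiv v1 p. 2) with §2 eq. (4) (p. 5)] -/
theorem false_of_interleaved_link (D₃ : TriMarkedDomain 3) (hV : D₃.verts = D.verts) (hC : ∀ a : Fin 3, yc D₃ a ∈ corners D)
    {v : HexVertex} (hv : AllSides D v) {i : Fin 3} {s : HexVertex} (hs : s ∈ ({v, oppFace v i} : Finset HexVertex))
    (hsc : s ∉ corners D) {g o : Site 2} (he : side v i = s(g, o)) (hg : g ∈ D.verts) (ho : o ∉ D.verts)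
    (hst : D₃.stretchIdx₃ (D₃.dpos (g, o)) = 0) {ξ : Finset (Sym2 (Site 2))} (hξ : ξ ∈ TXb D v i s)
    (h2 : XiLinked ξ s (yc D₃ 2)) (h01 : XiLinked ξ (yc D₃ 0) (yc D₃ 1)) : False := by
  classical
  have hB : hBonds D₃ = hBonds D := hBonds_eq_of_verts_eq hV
  -- basic facts about ξ
  have hξ' := (mem_TXb_iff (D := D) v i s ξ).1 hξ
  obtain ⟨hsub, hpar⟩ := hξ'
  have hξh : ξ ⊆ hBonds D := fun b hb => Finset.mem_of_mem_erase (hsub hb)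
  have hdeg : ∀ F, xiDeg ξ F ≤ 2 := xiDeg_le_two_of_mem_TXb D i hs hξ
  -- corner faces of D₃ are odd in ξ, s is odd, and they are pairwise distinct
  have hyc_odd : ∀ a : Fin 3, Odd (xiDeg ξ (yc D₃ a)) := by
    intro a
    have hmem : yc D₃ a ∈ triFacesTouching D.verts := by rw [← hV]; exact yc_mem_touching D₃ a
    rw [hpar _ hmem, Finset.mem_symmDiff, Finset.mem_singleton]
    left
    exact ⟨hC a, fun h => hsc (h ▸ hC a)⟩
  have hs_touch : s ∈ triFacesTouching D.verts := by
    have hb : side v i ∈ hBonds D := hv i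
    rw [Finset.mem_insert, Finset.mem_singleton] at hs
    rcases hs with rfl | rfl
    · exact mem_touching_of_side_mem D hb
    · exact mem_touching_of_side_mem D (j := oppIdx v i) (by rw [side_oppFace_oppIdx]; exact hb)
  have hs_odd : Odd (xiDeg ξ s) := by
    rw [hpar _ hs_touch, Finset.mem_symmDiff, Finset.mem_singleton]
    right; exact ⟨rfl, hsc⟩
  have hyc_ne_s : ∀ a : Fin 3, yc D₃ a ≠ s := fun a h => hsc (h ▸ hC a)
  have hyc_inj : ∀ a b : Fin 3, yc D₃ a = yc D₃ b → a = b := fun a b h =>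
    cornerFace_idx_unique D₃ (yc_spec D₃ a) (h ▸ yc_spec D₃ b)
  -- reachability
  have hR2 : (sideGraph ξ).Reachable s (yc D₃ 2) := (xiLinked_iff_reachable ξ _ _).1 h2
  have hR01 : (sideGraph ξ).Reachable (yc D₃ 0) (yc D₃ 1) := (xiLinked_iff_reachable ξ _ _).1 h01
  have h0_touch : yc D₃ 0 ∈ triFacesTouching D.verts := by rw [← hV]; exact yc_mem_touching D₃ 0
  -- the odd faces met from s are {s, y'₂}; from y'₀ they are {y'₀, y'₁}
  have hodd_s : ∀ F, (sideGraph ξ).Reachable s F → Odd (xiDeg ξ F) → F = s ∨ F = yc D₃ 2 :=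
    fun F hF hoF => odd_faces_of_component (D := D) hξh hdeg hs_touch hs_odd hR2 (hyc_odd 2) (hyc_ne_s 2) hF hoF
  have hodd_0 : ∀ F, (sideGraph ξ).Reachable (yc D₃ 0) F → Odd (xiDeg ξ F) → F = yc D₃ 0 ∨ F = yc D₃ 1 :=
    fun F hF hoF => odd_faces_of_component (D := D) hξh hdeg h0_touch (hyc_odd 0) hR01 (hyc_odd 1)
      (fun h => absurd (hyc_inj 1 0 h) (by decide)) hF hoF
  -- the two components are different: y'₀ is not reachable from s
  have hnot0 : ¬ (sideGraph ξ).Reachable s (yc D₃ 0) := by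
    intro h
    rcases hodd_s _ h (hyc_odd 0) with e | e
    · exact hyc_ne_s 0 e
    · exact absurd (hyc_inj 0 2 e) (by decide)
  have hnot1 : ¬ (sideGraph ξ).Reachable s (yc D₃ 1) := by
    intro h
    rcases hodd_s _ h (hyc_odd 1) with e | e
    · exact hyc_ne_s 1 e
    · exact absurd (hyc_inj 1 2 e) (by decide)
  have hnot2' : ¬ (sideGraph ξ).Reachable (yc D₃ 0) (yc D₃ 2) := by
    intro h
    rcases hodd_0 _ h (hyc_odd 2) with e | e
    · exact absurd (hyc_inj 2 0 e) (by decide)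
    · exact absurd (hyc_inj 2 1 e) (by decide)
  have hnots' : ¬ (sideGraph ξ).Reachable (yc D₃ 0) s := fun h => hnot0 h.symm
  -- the restricted configuration ξ' = components of s and y'₀
  set ξ' := restrictOn ξ s (yc D₃ 0) with hξ'def
  have hξ'sub : ξ' ⊆ (hBonds D₃).erase (side v i) := fun b hb => by rw [hB]; exact hsub (restrictOn_subset ξ _ _ hb)
  -- its parity profile is `corners D₃ Δ {s}`
  have hpar' : ParityIs D₃ ξ' (symmDiff (corners D₃) ({s} : Finset HexVertex)) := by
    intro F hF
    rw [Finset.mem_symmDiff, Finset.mem_singleton, mem_corners]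
    by_cases hP : (sideGraph ξ).Reachable s F ∨ (sideGraph ξ).Reachable (yc D₃ 0) F
    · rw [hξ'def, xiDeg_restrictOn_of_mem hP]
      constructor
      · intro hoF
        rcases hP with hP | hP
        · rcases hodd_s F hP hoF with rfl | rfl
          · right; exact ⟨rfl, fun ⟨a, ha⟩ => hyc_ne_s a ha.symm⟩
          · left; exact ⟨⟨2, rfl⟩, hyc_ne_s 2⟩
        · rcases hodd_0 F hP hoF with rfl | rfl
          · left; exact ⟨⟨0, rfl⟩, hyc_ne_s 0⟩
          · left; exact ⟨⟨1, rfl⟩, hyc_ne_s 1⟩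
      · rintro (⟨⟨a, rfl⟩, -⟩ | ⟨rfl, -⟩)
        · exact hyc_odd a
        · exact hs_odd
    · rw [hξ'def, xiDeg_restrictOn_of_not_mem (D := D) hξh hP]
      constructor
      · intro h; exact absurd h (by decide)
      · rintro (⟨⟨a, rfl⟩, -⟩ | ⟨rfl, -⟩)
        · exfalso
          have h3 : ∀ a' : Fin 3, a' = 0 ∨ a' = 1 ∨ a' = 2 := by decide
          rcases h3 a with rfl | rfl | rfl
          · exact hP (Or.inr SimpleGraph.Reachable.rfl)
          · exact hP (Or.inr hR01)
          · exact hP (Or.inl hR2)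
        · exact absurd (Or.inl SimpleGraph.Reachable.rfl) hP
  have hξ'mem : ξ' ∈ TXb D₃ v i s := (mem_TXb_iff (D := D₃) v i s ξ').2 ⟨hξ'sub, hpar'⟩
  -- and it lies in the class `[z ↔ u'₂]`
  have hcl : InClassX D₃ (faceVertex v (i + 1)) (faceVertex v (i + 2)) s 2 ξ' :=
    ⟨hξ'mem, yc D₃ 2, yc_spec D₃ 2, xiLinked_restrictOn (Or.inl SimpleGraph.Reachable.rfl) h2⟩
  -- which is empty by the k = 3 boundary-value theorem
  have hv₃ : AllSides D₃ v := fun j => by rw [hB]; exact hv j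
  have hcount := classCount_two_eq_zero_of_stretch_zero (D := D₃) hv₃ he (hV ▸ hg) (hV ▸ ho) hst
  unfold classCount at hcount
  have hboth := Nat.eq_zero_of_add_eq_zero hcount
  rw [Finset.mem_insert, Finset.mem_singleton] at hs
  rcases hs with rfl | rfl
  · have h0 := hboth.1
    rw [Finset.card_eq_zero, Finset.filter_eq_empty_iff] at h0
    exact h0 hξ'mem hcl
  · have h0 := hboth.2
    rw [Finset.card_eq_zero, Finset.filter_eq_empty_iff] at h0
    exact h0 hξ'mem hcl

end Interleaved

section Remark3

variable {nm : ℕ} (D : TriMarkedDomain nm)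

/-- iterating past whole periods. [cite: BollobasRiordan2006, Ch. 7 §7.2.2 pp. 191–193] -/
theorem iter_add_mul_card (n q : ℕ) :
    triBdryIter D.verts D.base (n + q * #(triBdryDarts D.verts)) = triBdryIter D.verts D.base n := by
  induction q with
  | zero => rw [Nat.zero_mul, Nat.add_zero]
  | succ q ih => rw [Nat.succ_mul, ← add_assoc, D.isTriDisc.iter_add_card, ih]

/-- markability past whole periods. [cite: BollobasRiordan2006, Ch. 7 §7.2.2 pp. 191–193] -/
theorem markable_add_mul_card {n : ℕ} (q : ℕ) (h : D.Markable n) : D.Markable (n + q * #(triBdryDarts D.verts)) := by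
  induction q with
  | zero => rwa [Nat.zero_mul, Nat.add_zero]
  | succ q ih => rw [Nat.succ_mul, ← add_assoc, add_comm]; exact D.markable_card_add.2 ih

/-- the dart at a lifted mark position is the marked dart. [folklore] -/
private theorem iter_pos_or_add {c : Fin nm} {n : ℕ} (h : ∃ q : ℕ, n = D.pos c + q * #(triBdryDarts D.verts)) :
    triBdryIter D.verts D.base n = D.markDart c := by
  obtain ⟨q, rfl⟩ := h
  exact iter_add_mul_card D _ _

/-- ★ **THE THREE-MARK RE-MARKING of a `k`-marked domain at three of its marks** `c 0, c 1, c 2` read in cyclic order from `c 0`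
(positions `m t ∈ {pos (c t), pos (c t) + L}`, strictly increasing, within one period): a `TriMarkedDomain 3` on the same sites whose
corner faces are the corner faces `y_{c t}` of `D` and whose first stretch consists of the old darts at positions `[m 0, m 1)`.
[cite: BollobasRiordan2006, Ch. 7 §7.2.3 p. 197 («or by relabelling», after Lemma 6)] -/
theorem exists_remark₃ (c : Fin 3 → Fin nm) (m : Fin 3 → ℕ) (hm : StrictMono m)
    (hL : ∀ t, m t < m 0 + #(triBdryDarts D.verts)) (hmc : ∀ t, ∃ q : ℕ, m t = D.pos (c t) + q * #(triBdryDarts D.verts))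
    (hc : Function.Injective c) :
    ∃ D₃ : TriMarkedDomain 3, D₃.verts = D.verts ∧ (∀ t, yc D₃ t = yc D (c t)) ∧
      ∀ n, m 0 ≤ n → n < m 1 → triBdryIter D.verts D.base n ∈ D₃.stretch 0 := by
  classical
  -- the marked darts at the new positions are the old marked darts
  have hmd : ∀ t, triBdryIter D.verts D.base (m t) = D.markDart (c t) := fun t => iter_pos_or_add D (hmc t)
  have hmk : ∀ t, D.Markable (m t) := by
    intro t
    obtain ⟨q, h⟩ := hmc t
    rw [h]; exact markable_add_mul_card D q (D.markable_pos (c t))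
  have hinj : Function.Injective fun t => (triBdryIter D.verts D.base (m t)).1 := by
    intro t t' h
    simp only [hmd] at h
    exact hc (D.mark_injective h)
  refine ⟨D.remark m hm hL hmk hinj, rfl, fun t => ?_, fun n hn1 hn2 => ?_⟩
  · -- corner faces: the new mark dart / predecessor dart are the old ones of the mark `c t`
    symm
    apply eq_yc
    have hY := yc_spec D (c t)
    unfold IsCornerFace at hY ⊢
    rw [hY]
    have h0t : m 0 ≤ m t := hm.monotone (Fin.zero_le t)
    have e1 : (D.remark m hm hL hmk hinj).markDart t = D.markDart (c t) := by
      show triBdryIter (D.remark m hm hL hmk hinj).verts (D.remark m hm hL hmk hinj).base ((D.remark m hm hL hmk hinj).pos t) = _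
      rw [remark_iter, remark_pos, Nat.add_sub_cancel' h0t, hmd]
    have e2 : (D.remark m hm hL hmk hinj).markSite t = D.markSite (c t) := by
      unfold markSite; rw [e1]
    have e3 : predDart (D.remark m hm hL hmk hinj) t = predDart D (c t) := by
      unfold predDart
      show triBdryIter (D.remark m hm hL hmk hinj).verts (D.remark m hm hL hmk hinj).base _ = _
      rw [remark_iter, remark_pos]
      unfold TriMarkedDomain.bdryLen
      rw [remark_verts, ← add_assoc, Nat.add_sub_cancel' h0t]
      obtain ⟨q, h⟩ := hmc t
      rw [h, add_assoc, add_comm (q * #(triBdryDarts D.verts)) _, ← add_assoc]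
      exact iter_add_mul_card D _ _
    rw [e1, e2, e3]
  · rw [remark_stretch]
    refine Finset.mem_image.2 ⟨n, Finset.mem_Ico.2 ⟨hn1, ?_⟩, rfl⟩
    unfold TriMarkedDomain.remarkNext
    simp only [show (0 : Fin 3).val + 1 < 2 + 1 by decide, dif_pos]
    exact hn2

end Remark3

section Support

variable {nm : ℕ} {D : TriMarkedDomain nm}

/-- **the gap index of a corner seen from the arc `A_a`**: the number of corners met, going anticlockwise from the arc `A_a`, strictly
before `y_x` — `y_{a+1} ↦ 0`, `y_{a+2} ↦ 1`, …, `y_a ↦ k − 1`. [cite: KhristoforovSmirnov2021, §1.2 (arXiv v1 p. 2: the counterclockwise order of the marked points)] -/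
def gapIdx (nm : ℕ) (a x : Fin nm) : ℕ := if a.val < x.val then x.val - a.val - 1 else x.val + nm - a.val - 1

/-- the gap index is `< k`. [folklore] -/
private theorem gapIdx_lt (a x : Fin nm) : gapIdx nm a x < nm := by
  unfold gapIdx; split_ifs with h <;> omega

/-- the gap index is injective in the corner. [folklore] -/
private theorem gapIdx_injective (a : Fin nm) : Function.Injective (gapIdx nm a) := by
  intro x y h
  unfold gapIdx at h
  apply Fin.ext
  split_ifs at h with h1 h2 h2 <;> omega

/-- every value `< k` is a gap index. [folklore] -/
private theorem exists_gapIdx_eq (a : Fin nm) {t : ℕ} (ht : t < nm) : ∃ x : Fin nm, gapIdx nm a x = t := by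
  by_cases h : a.val + 1 + t < nm
  · refine ⟨⟨a.val + 1 + t, h⟩, ?_⟩
    unfold gapIdx; simp only; rw [if_pos (by omega)]; omega
  · refine ⟨⟨a.val + 1 + t - nm, by omega⟩, ?_⟩
    unfold gapIdx; simp only; rw [if_neg (by omega)]; omega

/-- ★ **the corners of gap index below `t ≤ k` are `t` in number** (the marked points in their counterclockwise order). [cite: KhristoforovSmirnov2021, §1.2 (arXiv v1 p. 2)] -/
theorem card_filter_gapIdx_lt (a : Fin nm) {t : ℕ} (ht : t ≤ nm) :
    #((Finset.univ : Finset (Fin nm)).filter fun x => gapIdx nm a x < t) = t := by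
  classical
  have himg : ((Finset.univ : Finset (Fin nm)).filter fun x => gapIdx nm a x < t).image (gapIdx nm a) = Finset.range t := by
    ext u
    simp only [Finset.mem_image, Finset.mem_filter, Finset.mem_univ, true_and, Finset.mem_range]
    constructor
    · rintro ⟨x, hx, rfl⟩; exact hx
    · intro hu
      obtain ⟨x, hx⟩ := exists_gapIdx_eq a (lt_of_lt_of_le hu ht)
      exact ⟨x, hx ▸ hu, hx⟩
  have h := Finset.card_image_of_injective ((Finset.univ : Finset (Fin nm)).filter fun x => gapIdx nm a x < t) (gapIdx_injective a)
  rw [himg, Finset.card_range] at h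
  exact h.symm

/-- **the position of a corner relative to the dart of `z`** (at position `n₀` of the stretch `A_a`), lifted to `(0, L]`: the number of
boundary steps from `z` to the marked dart of `y_x`, the corner `y_a` counted LAST. [cite: BollobasRiordan2006, Ch. 7 §7.2.2 pp. 191–193] -/
noncomputable def relPos (D : TriMarkedDomain nm) (n₀ : ℕ) (x : Fin nm) : ℕ :=
  if n₀ < D.pos x then D.pos x - n₀ else D.pos x + #(triBdryDarts D.verts) - n₀

/-- `nextPos` below the last mark. [cite: BollobasRiordan2006, Ch. 7 §7.2.2 pp. 191–193] -/
theorem nextPos_eq_pos_succ (a : Fin nm) (h : a.val + 1 < nm) : D.nextPos a = D.pos ⟨a.val + 1, h⟩ := by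
  unfold TriMarkedDomain.nextPos; rw [dif_pos h]

/-- a dart of the stretch `A_a`: its position. [cite: BollobasRiordan2006, Ch. 7 §7.2.2 pp. 191–193] -/
theorem pos_facts_of_mem_stretch {a : Fin nm} {d : Site 2 × Site 2} (hd : d ∈ D.stretch a) :
    D.pos a ≤ D.dpos d ∧ D.dpos d < D.nextPos a ∧ D.dpos d < #(triBdryDarts D.verts) ∧
      triBdryIter D.verts D.base (D.dpos d) = d ∧ d ∈ triBdryDarts D.verts := by
  unfold TriMarkedDomain.stretch at hd
  obtain ⟨n, hn, rfl⟩ := Finset.mem_image.1 hd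
  rw [Finset.mem_Ico] at hn
  have hnL : n < #(triBdryDarts D.verts) := lt_of_lt_of_le hn.2 (D.nextPos_le_bdryLen a)
  have hdp : D.dpos (triBdryIter D.verts D.base n) = n := by rw [D.dpos_iter, Nat.mod_eq_of_lt hnL]
  rw [hdp]
  exact ⟨hn.1, hn.2, hnL, rfl, triBdryIter_mem D.base_mem n⟩

/-- corners after the arc (index `> a`) sit after the dart of `z`. [cite: BollobasRiordan2006, Ch. 7 §7.2.2 pp. 191–193] -/
theorem lt_pos_of_lt {a x : Fin nm} {n₀ : ℕ} (hn : n₀ < D.nextPos a) (hx : a.val < x.val) : n₀ < D.pos x := by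
  have h : a.val + 1 < nm := lt_of_le_of_lt hx x.isLt
  rw [nextPos_eq_pos_succ a h] at hn
  exact lt_of_lt_of_le hn (D.pos_strictMono.monotone (show (⟨a.val + 1, h⟩ : Fin nm) ≤ x from hx))

/-- corners up to the arc (index `≤ a`) sit at or before the dart of `z`. [cite: BollobasRiordan2006, Ch. 7 §7.2.2 pp. 191–193] -/
theorem pos_le_of_le {a x : Fin nm} {n₀ : ℕ} (hn : D.pos a ≤ n₀) (hx : x.val ≤ a.val) : D.pos x ≤ n₀ :=
  le_trans (D.pos_strictMono.monotone (show x ≤ a from hx)) hn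

/-- the relative position is positive and at most one period. [cite: BollobasRiordan2006, Ch. 7 §7.2.2 pp. 191–193] -/
theorem relPos_pos_le {a : Fin nm} {n₀ : ℕ} (hn' : n₀ < D.nextPos a) (x : Fin nm) :
    0 < relPos D n₀ x ∧ relPos D n₀ x ≤ #(triBdryDarts D.verts) := by
  have hL : n₀ < #(triBdryDarts D.verts) := lt_of_lt_of_le hn' (D.nextPos_le_bdryLen a)
  have hpx : D.pos x < #(triBdryDarts D.verts) := D.pos_lt x
  unfold relPos
  split_ifs with h
  · exact ⟨by omega, by omega⟩
  · exact ⟨by omega, by omega⟩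

/-- `n₀ + relPos` is the mark position up to whole periods. [cite: BollobasRiordan2006, Ch. 7 §7.2.2 pp. 191–193] -/
theorem exists_relPos_eq {n₀ : ℕ} (hn₀ : n₀ < #(triBdryDarts D.verts)) (x : Fin nm) :
    ∃ q : ℕ, n₀ + relPos D n₀ x = D.pos x + q * #(triBdryDarts D.verts) := by
  have hpx : D.pos x < #(triBdryDarts D.verts) := D.pos_lt x
  unfold relPos
  split_ifs with h
  · exact ⟨0, by omega⟩
  · exact ⟨1, by omega⟩

/-- ★ **the relative position is strictly increasing in the gap index** (the marks are met in their cyclic order along the boundary traversal). [cite: BollobasRiordan2006, Ch. 7 §7.2.2 pp. 191–193] -/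
theorem relPos_lt_relPos {a : Fin nm} {n₀ : ℕ} (hn : D.pos a ≤ n₀) (hn' : n₀ < D.nextPos a) {x y : Fin nm}
    (h : gapIdx nm a x < gapIdx nm a y) : relPos D n₀ x < relPos D n₀ y := by
  have hL : n₀ < #(triBdryDarts D.verts) := lt_of_lt_of_le hn' (D.nextPos_le_bdryLen a)
  have hpx : D.pos x < #(triBdryDarts D.verts) := D.pos_lt x
  have hpy : D.pos y < #(triBdryDarts D.verts) := D.pos_lt y
  unfold gapIdx at h
  by_cases hx : a.val < x.val
  · have hnx : n₀ < D.pos x := lt_pos_of_lt hn' hx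
    by_cases hy : a.val < y.val
    · have hny : n₀ < D.pos y := lt_pos_of_lt hn' hy
      rw [if_pos hx, if_pos hy] at h
      have hxy : x < y := by change x.val < y.val; omega
      have := D.pos_strictMono hxy
      unfold relPos; rw [if_pos hnx, if_pos hny]; omega
    · push Not at hy
      have hny : D.pos y ≤ n₀ := pos_le_of_le hn hy
      unfold relPos; rw [if_pos hnx, if_neg (not_lt.2 hny)]; omega
  · push Not at hx
    have hnx : D.pos x ≤ n₀ := pos_le_of_le hn hx
    by_cases hy : a.val < y.val
    · rw [if_neg (not_lt.2 hx), if_pos hy] at h; omega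
    · push Not at hy
      have hny : D.pos y ≤ n₀ := pos_le_of_le hn hy
      rw [if_neg (not_lt.2 hx), if_neg (not_lt.2 hy)] at h
      have hxy : x < y := by change x.val < y.val; omega
      have := D.pos_strictMono hxy
      unfold relPos; rw [if_neg (not_lt.2 hnx), if_neg (not_lt.2 hny)]; omega

/-- a finite set carried to itself by a fixed-point-free involution has even cardinality. [folklore] -/
private theorem even_card_of_involution {α : Type*} [DecidableEq α] (S : Finset α) (f : α → α) (hf : ∀ x ∈ S, f x ∈ S)
    (hinv : ∀ x ∈ S, f (f x) = x) (hne : ∀ x ∈ S, f x ≠ x) : Even #S := by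
  induction hN : #S using Nat.strong_induction_on generalizing S with
  | _ N ih =>
    subst hN
    rcases S.eq_empty_or_nonempty with rfl | ⟨x, hx⟩
    · simp
    · set S' := (S.erase x).erase (f x) with hS'
      have hfx : f x ∈ S.erase x := Finset.mem_erase.2 ⟨hne x hx, hf x hx⟩
      have hcard : #S = #S' + 2 := by
        rw [hS', Finset.card_erase_of_mem hfx, Finset.card_erase_of_mem hx]
        have : 2 ≤ #S := by
          have h1 : 1 ≤ #(S.erase x) := Finset.card_pos.2 ⟨f x, hfx⟩
          rw [Finset.card_erase_of_mem hx] at h1; omega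
        omega
      have hmem' : ∀ y ∈ S', y ∈ S ∧ y ≠ x ∧ y ≠ f x := by
        intro y hy
        rw [hS', Finset.mem_erase, Finset.mem_erase] at hy
        exact ⟨hy.2.2, hy.2.1, hy.1⟩
      have hf' : ∀ y ∈ S', f y ∈ S' := by
        intro y hy
        obtain ⟨hyS, hyx, hyfx⟩ := hmem' y hy
        rw [hS', Finset.mem_erase, Finset.mem_erase]
        refine ⟨fun h => hyx ?_, fun h => hyfx ?_, hf y hyS⟩
        · rw [← hinv y hyS, h, hinv x hx]
        · rw [← hinv y hyS, h]
      have hev : Even #S' := ih #S' (by omega) S' hf' (fun y hy => hinv y (hmem' y hy).1) (fun y hy => hne y (hmem' y hy).1) rfl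
      rw [hcard]
      exact hev.add (by decide)

/-- ★★★ **THE BOUNDARY SUPPORT LAW, loop side, ANY number of marks**: at a boundary mid-edge `z` of the arc `A_a` (read at a face with
three `H_G`-sides, odd endpoint `s` not a corner), NO configuration of `W_Ω(u₁,…,u_k,z)` links `z` to a corner `u_j` with an ODD number
of corners strictly between the arc and `u_j` — the admissible partners of `z ∈ A_a` are `u_{a+1}, u_{a+3}, …, u_a`. Instances: `k = 3`,
`H_{a+2}(z) = 0` (the two-term form of Khristoforov–Smirnov eq. (4), p. 5); `k = 5`, the partner part of the lane's boundary support (B∂).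
[cite: KhristoforovSmirnov2021, §1.2 (arXiv v1 p. 2) and §2 eq. (4) (p. 5)] -/
theorem not_inClassX_of_odd_gap {v : HexVertex} (hv : AllSides D v) {i : Fin 3} {s : HexVertex}
    (hs : s ∈ ({v, oppFace v i} : Finset HexVertex)) (hsc : s ∉ corners D) {g o : Site 2} (he : side v i = s(g, o))
    {a : Fin nm} (hd : (g, o) ∈ D.stretch a) {j : Fin nm} (hgap : Odd (gapIdx nm a j))
    {ξ : Finset (Sym2 (Site 2))} (hξ : ξ ∈ TXb D v i s) :
    ¬ InClassX D (faceVertex v (i + 1)) (faceVertex v (i + 2)) s j ξ := by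
  classical
  rintro ⟨-, Y, hY, hlink⟩
  have hYj : Y = yc D j := eq_yc D hY
  subst hYj
  obtain ⟨hpa, hnext, hL0, hbd, hmem⟩ := pos_facts_of_mem_stretch hd
  obtain ⟨hg, ho, -⟩ := mem_triBdryDarts.1 hmem
  set n₀ := D.dpos (g, o) with hn₀
  -- basic facts about ξ
  obtain ⟨hsub, hpar⟩ := (mem_TXb_iff (D := D) v i s ξ).1 hξ
  have hξh : ξ ⊆ hBonds D := fun b hb => Finset.mem_of_mem_erase (hsub hb)
  have hdeg : ∀ F, xiDeg ξ F ≤ 2 := xiDeg_le_two_of_mem_TXb D i hs hξ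
  have hyc_odd : ∀ c : Fin nm, Odd (xiDeg ξ (yc D c)) := by
    intro c
    rw [hpar _ (yc_mem_touching D c), Finset.mem_symmDiff, Finset.mem_singleton]
    left; exact ⟨yc_mem_corners D c, fun h => hsc (h ▸ yc_mem_corners D c)⟩
  have hs_touch : s ∈ triFacesTouching D.verts := by
    have hb : side v i ∈ hBonds D := hv i
    rw [Finset.mem_insert, Finset.mem_singleton] at hs
    rcases hs with rfl | rfl
    · exact mem_touching_of_side_mem D hb
    · exact mem_touching_of_side_mem D (j := oppIdx v i) (by rw [side_oppFace_oppIdx]; exact hb)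
  have hs_odd : Odd (xiDeg ξ s) := by
    rw [hpar _ hs_touch, Finset.mem_symmDiff, Finset.mem_singleton]
    right; exact ⟨rfl, hsc⟩
  have hyc_ne_s : ∀ c : Fin nm, yc D c ≠ s := fun c h => hsc (h ▸ yc_mem_corners D c)
  have hyc_inj : ∀ c c' : Fin nm, yc D c = yc D c' → c = c' := fun c c' h =>
    cornerFace_idx_unique D (yc_spec D c) (h ▸ yc_spec D c')
  have hRj : (sideGraph ξ).Reachable s (yc D j) := (xiLinked_iff_reachable ξ _ _).1 hlink
  -- the odd faces met from s are {s, y_j}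
  have hodd_s : ∀ F, (sideGraph ξ).Reachable s F → Odd (xiDeg ξ F) → F = s ∨ F = yc D j :=
    fun F hF hoF => odd_faces_of_component (D := D) hξh hdeg hs_touch hs_odd hRj (hyc_odd j) (hyc_ne_s j) hF hoF
  -- the partner of a corner other than y_j is a corner other than itself and y_j
  have partner : ∀ c : Fin nm, c ≠ j → ∃ c' : Fin nm, c' ≠ c ∧ c' ≠ j ∧ (sideGraph ξ).Reachable (yc D c) (yc D c') ∧
      ∀ F, (sideGraph ξ).Reachable (yc D c) F → Odd (xiDeg ξ F) → F = yc D c ∨ F = yc D c' := by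
    intro c hcj
    obtain ⟨⟨Y₂, hne, hodd2, hreach⟩, huniq⟩ := odd_component D hξh hdeg (yc_mem_touching D c) (hyc_odd c)
    -- Y₂ is not s (else y_c would be met from s), hence a corner
    have hY₂s : Y₂ ≠ s := by
      intro h; subst h
      rcases hodd_s _ hreach.symm (hyc_odd c) with e | e
      · exact hyc_ne_s c e
      · exact hcj (hyc_inj _ _ e)
    have hY₂touch : Y₂ ∈ triFacesTouching D.verts := touching_of_reachable D hξh (yc_mem_touching D c) hreach
    have hY₂c : Y₂ ∈ corners D := by
      have := (hpar _ hY₂touch).1 hodd2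
      rw [Finset.mem_symmDiff, Finset.mem_singleton] at this
      rcases this with ⟨h, -⟩ | ⟨h, -⟩
      · exact h
      · exact absurd h hY₂s
    obtain ⟨c', rfl⟩ := (mem_corners D).1 hY₂c
    refine ⟨c', fun h => hne (by rw [h]), fun h => ?_, hreach, fun F hF hoF => ?_⟩
    · subst h
      rcases hodd_s _ (hRj.trans hreach.symm) (hyc_odd c) with e | e
      · exact hyc_ne_s c e
      · exact hcj (hyc_inj _ _ e)
    · by_cases hFc : F = yc D c
      · exact Or.inl hFc
      · exact Or.inr ((huniq _ F hreach hF hodd2 hoF hne hFc).symm)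
  choose! π hπne hπj hπreach hπodd using partner
  -- π is an involution on the corners other than y_j
  have hπinv : ∀ c, c ≠ j → π (π c) = c := by
    intro c hcj
    have h1 := hπreach c hcj
    have h2 := hπreach (π c) (hπj c hcj)
    -- y_c is odd and reachable from y_{π c}: it is y_{π c} or y_{π (π c)}
    rcases hπodd (π c) (hπj c hcj) _ h1.symm (hyc_odd c) with e | e
    · exact absurd (hyc_inj _ _ e).symm (hπne c hcj)
    · exact (hyc_inj _ _ e).symm
  -- π preserves the side of the strand of z: otherwise the two strands interleave
  set G1 : Finset (Fin nm) := Finset.univ.filter fun c => gapIdx nm a c < gapIdx nm a j with hG1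
  have hjG1 : j ∉ G1 := by rw [hG1, Finset.mem_filter]; exact fun h => lt_irrefl _ h.2
  have hπG1 : ∀ c ∈ G1, π c ∈ G1 := by
    intro c hc
    rw [hG1, Finset.mem_filter] at hc
    obtain ⟨-, hc⟩ := hc
    have hcj : c ≠ j := fun h => by rw [h] at hc; exact lt_irrefl _ hc
    by_contra hout
    rw [hG1, Finset.mem_filter] at hout
    have hout' : gapIdx nm a j < gapIdx nm a (π c) := by
      rcases lt_trichotomy (gapIdx nm a j) (gapIdx nm a (π c)) with h | h | h
      · exact h
      · exact absurd (gapIdx_injective a h).symm (hπj c hcj)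
      · exact absurd ⟨Finset.mem_univ _, h⟩ hout
    -- the three-mark re-marking at (y_{π c}, y_c, y_j), read from the dart of z
    set c' := π c with hc'
    have hr_c : relPos D n₀ c' < relPos D n₀ c + #(triBdryDarts D.verts) :=
      lt_of_le_of_lt (relPos_pos_le hnext c').2 (by have := (relPos_pos_le hnext c).1; omega)
    have hr_cj : relPos D n₀ c < relPos D n₀ j := relPos_lt_relPos hpa hnext hc
    have hr_jc' : relPos D n₀ j < relPos D n₀ c' := relPos_lt_relPos hpa hnext hout'
    let cv : Fin 3 → Fin nm := ![c', c, j]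
    let m : Fin 3 → ℕ := ![n₀ + relPos D n₀ c', n₀ + relPos D n₀ c + #(triBdryDarts D.verts),
      n₀ + relPos D n₀ j + #(triBdryDarts D.verts)]
    have hm : StrictMono m := by
      refine Fin.strictMono_iff_lt_succ.2 fun t => ?_
      fin_cases t
      · show n₀ + relPos D n₀ c' < n₀ + relPos D n₀ c + #(triBdryDarts D.verts); omega
      · show n₀ + relPos D n₀ c + #(triBdryDarts D.verts) < n₀ + relPos D n₀ j + #(triBdryDarts D.verts); omega
    have hLm : ∀ t, m t < m 0 + #(triBdryDarts D.verts) := by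
      intro t
      fin_cases t
      · show n₀ + relPos D n₀ c' < n₀ + relPos D n₀ c' + #(triBdryDarts D.verts); omega
      · show n₀ + relPos D n₀ c + #(triBdryDarts D.verts) < n₀ + relPos D n₀ c' + #(triBdryDarts D.verts); omega
      · show n₀ + relPos D n₀ j + #(triBdryDarts D.verts) < n₀ + relPos D n₀ c' + #(triBdryDarts D.verts); omega
    have hmc : ∀ t, ∃ q : ℕ, m t = D.pos (cv t) + q * #(triBdryDarts D.verts) := by
      intro t
      fin_cases t
      · obtain ⟨q, hq⟩ := exists_relPos_eq (D := D) hL0 c'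
        exact ⟨q, hq⟩
      · obtain ⟨q, hq⟩ := exists_relPos_eq (D := D) hL0 c
        exact ⟨q + 1, by show n₀ + relPos D n₀ c + _ = D.pos c + _; rw [hq]; ring⟩
      · obtain ⟨q, hq⟩ := exists_relPos_eq (D := D) hL0 j
        exact ⟨q + 1, by show n₀ + relPos D n₀ j + _ = D.pos j + _; rw [hq]; ring⟩
    have hcv : Function.Injective cv := by
      intro t t' h
      fin_cases t <;> fin_cases t'
      · rfl
      · exact absurd h (hπne c hcj)
      · exact absurd h (hπj c hcj)
      · exact absurd h.symm (hπne c hcj)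
      · rfl
      · exact absurd h hcj
      · exact absurd h.symm (hπj c hcj)
      · exact absurd h.symm hcj
      · rfl
    obtain ⟨D₃, hV, hyc, hstr⟩ := exists_remark₃ D cv m hm hLm hmc hcv
    -- z lies on the first arc of D₃
    have hz : (g, o) ∈ D₃.stretch 0 := by
      have h := hstr (n₀ + #(triBdryDarts D.verts)) (by show n₀ + relPos D n₀ c' ≤ _; have := (relPos_pos_le hnext c').2; omega)
        (by show _ < n₀ + relPos D n₀ c + #(triBdryDarts D.verts); have := (relPos_pos_le hnext c).1; omega)
      rwa [D.isTriDisc.iter_add_card, hbd] at h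
    have hst : D₃.stretchIdx₃ (D₃.dpos (g, o)) = 0 := stretchIdx₃_of_mem_stretch D₃ hz
    have hC : ∀ t : Fin 3, yc D₃ t ∈ corners D := fun t => by rw [hyc]; exact yc_mem_corners D _
    refine false_of_interleaved_link D₃ hV hC hv hs hsc he hg ho hst hξ ?_ ?_
    · rw [hyc]; exact hlink
    · rw [hyc, hyc]
      show XiLinked ξ (yc D c') (yc D c)
      exact (xiLinked_iff_reachable ξ _ _).2 (hπreach c hcj).symm
  -- hence #G1 is even; but #G1 = gapIdx a j is odd
  have heven : Even #G1 :=
    even_card_of_involution G1 π hπG1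
      (fun c hc => hπinv c (fun h => hjG1 (h ▸ hc))) (fun c hc => hπne c (fun h => hjG1 (h ▸ hc)))
  have hcard : #G1 = gapIdx nm a j := card_filter_gapIdx_lt a (gapIdx_lt a j).le
  rw [hcard] at heven
  exact (Nat.not_even_iff_odd.2 hgap) heven

end Support

section CornerEndpoint

variable {nm : ℕ} {D : TriMarkedDomain nm}

/-- three indices of `Fin 3` around a given one. [folklore] -/
private theorem fin3_around (w b : Fin 3) : b = w ∨ b = w + 1 ∨ b = w + 2 := by
  revert w b; decide

/-- **a corner endpoint is isolated**: if the odd endpoint `s ∈ {v, oppFace v i}` of the XOR space at the bond `side v i` IS a corner face,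
then it has no side in any configuration (its parity is even, and of its three sides one is the excluded bond and one is not in `H_G`),
so it is linked only to itself: the class `[z ↔ u_j]` forces `u_j = s`. [cite: KhristoforovSmirnov2021, §1.2 (arXiv v1 p. 2)] -/
theorem isCornerFace_of_inClassX_of_corner {v : HexVertex} (hv : AllSides D v) {i : Fin 3} {s : HexVertex}
    (hs : s ∈ ({v, oppFace v i} : Finset HexVertex)) (hsc : s ∈ corners D) {j : Fin nm}
    {ξ : Finset (Sym2 (Site 2))} (hcl : InClassX D (faceVertex v (i + 1)) (faceVertex v (i + 2)) s j ξ) : IsCornerFace D j s := by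
  classical
  obtain ⟨hmem, Y, hY, hlink⟩ := hcl
  have hξ : ξ ∈ TXb D v i s := hmem
  obtain ⟨hsub, hpar⟩ := (mem_TXb_iff (D := D) v i s ξ).1 hξ
  obtain ⟨m, hm⟩ := (mem_corners D).1 hsc
  have hms : IsCornerFace D m s := hm ▸ yc_spec D m
  -- the excluded bond is a side of s
  have hside : ∃ j₁ : Fin 3, side s j₁ = side v i := by
    rw [Finset.mem_insert, Finset.mem_singleton] at hs
    rcases hs with rfl | rfl
    · exact ⟨i, rfl⟩
    · exact ⟨oppIdx v i, side_oppFace_oppIdx v i⟩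
  obtain ⟨j₁, hj₁⟩ := hside
  obtain ⟨j₂, hj₂⟩ := exists_side_not_mem_hBonds_of_corner D hms
  have hj12 : j₁ ≠ j₂ := by
    intro h; subst h
    exact hj₂ (hj₁ ▸ hv i)
  -- no side of s lies in ξ
  have hdeg0 : ∀ j' : Fin 3, side s j' ∉ ξ := by
    -- the sides in ξ avoid j₁ (excluded) and j₂ (not in H_G): at most one; and their number is even
    have hnot1 : side s j₁ ∉ ξ := fun h => by
      have := hsub h; rw [hj₁] at this; exact (Finset.notMem_erase _ _) this
    have hnot2 : side s j₂ ∉ ξ := fun h => hj₂ (Finset.mem_of_mem_erase (hsub h))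
    have heven : ¬ Odd (xiDeg ξ s) := by
      have hs_touch : s ∈ triFacesTouching D.verts := hm ▸ yc_mem_touching D m
      rw [hpar _ hs_touch, Finset.mem_symmDiff, Finset.mem_singleton]
      push Not
      exact ⟨fun _ => rfl, fun _ => hsc⟩
    -- the sides of s in ξ avoid j₁ and j₂: at most one; their number is even: none
    have hle : xiDeg ξ s ≤ 1 := by
      unfold xiDeg
      have hsub' : ((Finset.univ : Finset (Fin 3)).filter fun j => s(faceVertex s (j + 1), faceVertex s (j + 2)) ∈ ξ) ⊆
          ((Finset.univ : Finset (Fin 3)).erase j₁).erase j₂ := by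
        intro j hj
        rw [Finset.mem_filter] at hj
        have hj' : side s j ∈ ξ := hj.2
        rw [Finset.mem_erase, Finset.mem_erase]
        exact ⟨fun h => hnot2 (h ▸ hj'), fun h => hnot1 (h ▸ hj'), Finset.mem_univ _⟩
      have hcard : #(((Finset.univ : Finset (Fin 3)).erase j₁).erase j₂) = 1 := by
        rw [Finset.card_erase_of_mem (Finset.mem_erase.2 ⟨hj12.symm, Finset.mem_univ _⟩), Finset.card_erase_of_mem (Finset.mem_univ _)]
        simp
      exact (Finset.card_le_card hsub').trans hcard.le
    have h0 : xiDeg ξ s = 0 := by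
      rcases Nat.even_or_odd (xiDeg ξ s) with h | h
      · obtain ⟨r, hr⟩ := h; omega
      · exact absurd h heven
    intro j' hj'
    have : 0 < xiDeg ξ s := by
      unfold xiDeg
      exact Finset.card_pos.2 ⟨j', Finset.mem_filter.2 ⟨Finset.mem_univ _, hj'⟩⟩
    omega
  -- hence s is linked only to itself
  have hYs : Y = s := by
    unfold XiLinked at hlink
    rcases hlink.cases_head with h | ⟨c, hsc', -⟩
    · exact h.symm
    · obtain ⟨j', -, hj'⟩ := hsc'
      exact absurd hj' (hdeg0 j')
  rw [← hYs]; exact hY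

/-- **the darts read at a corner face**: an `H_G`-side `s(g, o)` (`g ∈ G`, `o ∉ G`) of the corner face `y_m` is the marked dart of `m` or
its predecessor. [cite: BollobasRiordan2006, Ch. 7 §7.2.2 pp. 191–193] -/
theorem dart_eq_of_corner_side {m : Fin nm} {F : HexVertex} (hF : IsCornerFace D m F) {j : Fin 3} {g o : Site 2}
    (he : side F j = s(g, o)) (hg : g ∈ D.verts) (ho : o ∉ D.verts) : (g, o) = predDart D m ∨ (g, o) = D.markDart m := by
  obtain ⟨w, h0, h1, h2, hor⟩ := isCornerFace_typeII D hF
  have hg' : g ∈ hexFaceVertices F := by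
    have : g ∈ (side F j : Sym2 (Site 2)) := by rw [he]; exact Sym2.mem_mk_left g o
    unfold side at this
    rcases Sym2.mem_iff.1 this with e | e <;> rw [e] <;> exact faceVertex_mem _ _
  have hgw : g = faceVertex F w := by
    obtain ⟨a, ha⟩ := mem_hexFaceVertices_iff_faceVertex.1 hg'
    rcases fin3_around w a with e | e | e
    · rw [ha, e]
    · exact absurd (e ▸ ha ▸ hg) h1
    · exact absurd (e ▸ ha ▸ hg) h2
  have ho' : o ∈ hexFaceVertices F := by
    have : o ∈ (side F j : Sym2 (Site 2)) := by rw [he]; exact Sym2.mem_mk_right g o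
    unfold side at this
    rcases Sym2.mem_iff.1 this with e | e <;> rw [e] <;> exact faceVertex_mem _ _
  have hgo : g ≠ o := fun e => ho (e ▸ hg)
  obtain ⟨b, hb⟩ := mem_hexFaceVertices_iff_faceVertex.1 ho'
  have hb' : b = w + 1 ∨ b = w + 2 := by
    rcases fin3_around w b with e | e | e
    · exact absurd (hgw.trans (e ▸ hb).symm) hgo
    · exact Or.inl e
    · exact Or.inr e
  have hgm : g = D.markSite m := hgw.trans h0
  rcases hor with ⟨hp1, hm2⟩ | ⟨hm1, hp2⟩
  · rcases hb' with rfl | rfl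
    · exact Or.inl (Prod.ext (by rw [predDart_fst]; exact hgm) (by rw [hb]; exact hp1))
    · exact Or.inr (Prod.ext hgm (by rw [hb]; exact hm2))
  · rcases hb' with rfl | rfl
    · exact Or.inr (Prod.ext hgm (by rw [hb]; exact hm1))
    · exact Or.inl (Prod.ext (by rw [predDart_fst]; exact hgm) (by rw [hb]; exact hp2))

/-- the marked dart of `m` lies only on the stretch `A_m`: gap index `k − 1` from its own arc. [cite: BollobasRiordan2006, Ch. 7 §7.2.2 pp. 191–193] -/
theorem gapIdx_of_markDart_mem_stretch {a m : Fin nm} (hd : D.markDart m ∈ D.stretch a) : gapIdx nm a m = nm - 1 := by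
  obtain ⟨h1, h2, -, -, -⟩ := pos_facts_of_mem_stretch hd
  rw [dpos_markDart] at h1 h2
  have ham : a = m := by
    rcases lt_trichotomy a m with h | h | h
    · exfalso
      have hlt : a.val < m.val := h
      have := lt_pos_of_lt (D := D) h2 hlt
      exact lt_irrefl _ this
    · exact h
    · exfalso
      exact absurd h1 (not_le.2 (D.pos_strictMono h))
  subst ham
  unfold gapIdx
  rw [if_neg (lt_irrefl _)]
  omega

/-- the predecessor dart of the mark `m` lies on the stretch before it: gap index `0`. [cite: BollobasRiordan2006, Ch. 7 §7.2.2 pp. 191–193] -/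
theorem gapIdx_of_predDart_mem_stretch {a m : Fin nm} (hd : predDart D m ∈ D.stretch a) : gapIdx nm a m = 0 := by
  obtain ⟨h1, h2, hL, -, -⟩ := pos_facts_of_mem_stretch hd
  have hsucc := dpos_predDart_succ D m
  set n := D.dpos (predDart D m) with hn
  have hpm : D.pos m < #(triBdryDarts D.verts) := D.pos_lt m
  unfold gapIdx
  by_cases hwrap : n + 1 < #(triBdryDarts D.verts)
  · rw [Nat.mod_eq_of_lt hwrap] at hsucc
    -- pos m = n + 1: the mark m starts right after n, so a < m and a + 1 ≥ m
    have ham : a.val < m.val := by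
      by_contra hle
      push Not at hle
      have := pos_le_of_le (D := D) h1 hle
      omega
    rw [if_pos ham]
    have hle : m.val ≤ a.val + 1 := by
      by_contra hlt
      push Not at hlt
      have h' : a.val + 1 < nm := by omega
      rw [nextPos_eq_pos_succ a h'] at h2
      have := D.pos_strictMono (show (⟨a.val + 1, h'⟩ : Fin nm) < m from hlt)
      omega
    omega
  · -- n = L − 1: then pos m = 0, m = 0, and a is the last mark
    have hn1 : n + 1 = #(triBdryDarts D.verts) := by omega
    rw [hn1, Nat.mod_self] at hsucc
    have hm0 : m.val = 0 := by
      by_contra hne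
      have hpos : 0 < m.val := Nat.pos_of_ne_zero hne
      have hk : 0 < nm := lt_of_le_of_lt (Nat.zero_le _) m.isLt
      have := D.pos_strictMono (show (⟨0, hk⟩ : Fin nm) < m from hpos)
      rw [D.pos_zero hk] at this
      omega
    have ha : ¬ a.val < m.val := by rw [hm0]; exact Nat.not_lt_zero _
    rw [if_neg ha, hm0]
    -- a is the last index: nextPos a = L
    have hlast : a.val + 1 = nm := by
      by_contra hne
      have h' : a.val + 1 < nm := lt_of_le_of_ne a.isLt (fun h => hne h)
      rw [nextPos_eq_pos_succ a h'] at h2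
      have := D.pos_lt (⟨a.val + 1, h'⟩ : Fin nm)
      omega
    omega

/-- ★★★ **THE BOUNDARY SUPPORT LAW AT EVERY BOUNDARY MID-EDGE** (corner endpoints included), for an ODD number of marks: at a boundary
mid-edge `z` of `A_a`, read at a face with three `H_G`-sides, no configuration of the XOR space (either half) links `z` to a corner
`u_j` with an odd number of corners strictly between the arc and `u_j`. [cite: KhristoforovSmirnov2021, §1.2 (arXiv v1 p. 2) and §2 eq. (4) (p. 5)] -/
theorem not_inClassX_of_odd_gap' (hodd : Odd nm) {v : HexVertex} (hv : AllSides D v) {i : Fin 3} {s : HexVertex}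
    (hs : s ∈ ({v, oppFace v i} : Finset HexVertex)) {g o : Site 2} (he : side v i = s(g, o))
    {a : Fin nm} (hd : (g, o) ∈ D.stretch a) {j : Fin nm} (hgap : Odd (gapIdx nm a j))
    {ξ : Finset (Sym2 (Site 2))} (hξ : ξ ∈ TXb D v i s) :
    ¬ InClassX D (faceVertex v (i + 1)) (faceVertex v (i + 2)) s j ξ := by
  classical
  by_cases hsc : s ∈ corners D
  · intro hcl
    have hjs : IsCornerFace D j s := isCornerFace_of_inClassX_of_corner hv hs hsc hcl
    obtain ⟨-, -, -, -, hmem⟩ := pos_facts_of_mem_stretch hd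
    obtain ⟨hg, ho, -⟩ := mem_triBdryDarts.1 hmem
    -- the bond of z is an H_G-side of the corner face s = y_j: (g,o) is predDart j or markDart j
    have hside : ∃ j₁ : Fin 3, side s j₁ = s(g, o) := by
      rw [Finset.mem_insert, Finset.mem_singleton] at hs
      rcases hs with rfl | rfl
      · exact ⟨i, he⟩
      · exact ⟨oppIdx v i, by rw [side_oppFace_oppIdx]; exact he⟩
    obtain ⟨j₁, hj₁⟩ := hside
    rcases dart_eq_of_corner_side hjs hj₁ hg ho with hdd | hdd
    · rw [hdd] at hd
      rw [gapIdx_of_predDart_mem_stretch hd] at hgap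
      exact (Nat.not_odd_iff_even.2 (by decide : Even 0)) hgap
    · rw [hdd] at hd
      rw [gapIdx_of_markDart_mem_stretch hd] at hgap
      obtain ⟨r, hr⟩ := hodd
      have : Even (nm - 1) := ⟨r, by omega⟩
      exact (Nat.not_odd_iff_even.2 this) hgap
  · exact not_inClassX_of_odd_gap hv hs hsc he hd hgap hξ

end CornerEndpoint

end Literature.Probability.Percolation.MarkedLoops
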